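import Mathlib.Algebra.BigOperators.Ring.Finset
import Mathlib.Algebra.BigOperators.Fin
import Mathlib.Algebra.Order.BigOperators.Ring.Finset
import Mathlib.Data.Finset.Powerset
import Mathlib.Analysis.SpecialFunctions.Pow.Real
import Mathlib.Tactic.Linarith
import Mathlib.Tactic.Ring
import Mathlib.Tactic.Positivity
import Mathlib.Tactic.FieldSimp
import HarnessLib

/-!
# `NoHeavyLowerTail` (crux stmt-CriticalPhenomena-4575), master-family line P1 (gen 22):
# second-order Harris for sunflowers, IV — the INDEPENDENT STRATUM for every `k`: outside branch exact, kernel branch iff `κ ≥ o`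

Support file (seat `prim-masterthm-p1`, gen 22; `--supports stmt-CriticalPhenomena-4575`).  Pure real-inequality file (no definition, no
`sorry`, standard axioms), at the level of the cell masses; memo `run/shared/lean/prim/prim-masterthm/FROM-prim-masterthm-p1-g22-SUNFLOWER-ONE-PAYER.md` §4.

SETTING.  `G_1, …, G_k` independent events with `μ(G_i) = g_i` (e.g. increasing events determined by pairwise disjoint coordinate sets of a
product measure), `U_i = G_i ∪ Maj₂(G)` ("`G_i` or at least two of the others"): a `k`-sunflower with kernel `K = Maj₂(G)`, outside
`O = ⋂ G_iᶜ`, petals "only `G_i`" and complementary down-sets `D_i = ⋂_{j≠i} G_jᶜ` — the `k`-coordinate standard system std_k and all its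
read-once substitutions.  Its cell masses are `o = Π_i (1 − g_i)`, `c_i = g_i Π_{j≠i} (1 − g_j)`, `κ = 1 − o − Σ_i c_i`, and
`μ(U_i) = κ + c_i`, `μ(D_i) = o + c_i = Π_{j≠i}(1 − g_j)`.  In these terms (pattern masses `M_t = Π_{i∈t} g_i Π_{i∉t}(1−g_i)`, `κ = Σ_{|t|≥2} M_t`):
* `outside_exact_of_indepType`: **`Π_i (o + c_i) = o^{k−1}`** — the outside branch of the `k`-petal one-payer conjecture SOH_k
  (`SahiDeepCore.SunflowerOnePayer`) holds with EQUALITY on the stratum, for every `k` and every bias vector;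
* `kernel_le_of_indepType`: **`o ≤ κ ⟹ Π_i (κ + c_i) ≤ κ^{k−1}`** (`k ≥ 2`) — the kernel branch under the SOH_k hypothesis, via the identity
  `o·(κ^{k−1} − Π(κ + c_i)) = Σ_{|t|≥2} M_t · o² κ^{k−|t|} (κ^{|t|−2} − o^{|t|−2})`;
* `kernel_gt_of_indepType`: **`κ < o ⟹ κ^{k−1} < Π_i (κ + c_i)`** (`k ≥ 3`, all `g_i ∈ (0,1)`) — the switch `κ = o` is EXACT for every `k`:
  the hypothesis of SOH_k cannot be weakened at any level `k ≥ 3` (for `k = 3` this is gen 16's `e₃ = o·G` on std3).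
HONEST FRAMING: one stratum, all `k`; SOH_k / S₃^max in general remain OPEN. [this work]
-/

noncomputable section

open Finset

namespace Summit.CriticalPhenomena.PercolationContinuityZ3.Theorems

namespace SahiDeepCore.IndepType


variable {k : ℕ}

/-- Splitting a sum over all subsets of `Fin k` by cardinality `0`, `1`, `≥ 2`. [folklore] -/
theorem sum_powerset_split (f : Finset (Fin k) → ℝ) :
    ∑ t ∈ (univ : Finset (Fin k)).powerset, f t =
      f ∅ + ∑ i, f {i} + ∑ t ∈ (univ : Finset (Fin k)).powerset with 2 ≤ t.card, f t := by
  rw [← Finset.sum_filter_add_sum_filter_not _ (fun t : Finset (Fin k) => 2 ≤ t.card)]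
  have hsmall : (univ : Finset (Fin k)).powerset.filter (fun t => ¬ 2 ≤ t.card)
      = (univ : Finset (Fin k)).powersetCard 0 ∪ (univ : Finset (Fin k)).powersetCard 1 := by
    ext t
    simp only [Finset.mem_filter, Finset.mem_powerset, Finset.mem_union, Finset.mem_powersetCard, not_le,
      Finset.subset_univ, true_and]
    omega
  have hdisj : Disjoint ((univ : Finset (Fin k)).powersetCard 0) ((univ : Finset (Fin k)).powersetCard 1) :=
    Finset.disjoint_left.2 fun t h0 h1 => by
      rw [Finset.mem_powersetCard] at h0 h1; omega
  rw [hsmall, Finset.sum_union hdisj, Finset.powersetCard_zero, Finset.sum_singleton, Finset.powersetCard_one,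
    Finset.sum_map]
  simp only [Function.Embedding.coeFn_mk]
  ring

/-- The pattern expansion `Π_i (κ q_i + o g_i) = Σ_t o^{|t|} κ^{k−|t|} M_t`, `M_t = Π_{i∈t} g_i · Π_{i∉t} (1 − g_i)`. [this work] -/
theorem prod_expand (g : Fin k → ℝ) (κ o : ℝ) :
    ∏ i, (κ * (1 - g i) + o * g i) =
      ∑ t ∈ (univ : Finset (Fin k)).powerset, o ^ t.card * κ ^ (k - t.card) * ((∏ i ∈ t, g i) * ∏ i ∈ univ \ t, (1 - g i)) := by
  have h := Finset.prod_add (fun i => o * g i) (fun i => κ * (1 - g i)) (univ : Finset (Fin k))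
  have e : ∀ i : Fin k, κ * (1 - g i) + o * g i = o * g i + κ * (1 - g i) := fun i => by ring
  simp only [e]
  rw [h]
  refine Finset.sum_congr rfl fun t ht => ?_
  rw [Finset.prod_mul_distrib, Finset.prod_mul_distrib, Finset.prod_const, Finset.prod_const,
    Finset.card_sdiff_of_subset (Finset.mem_powerset.1 ht), Finset.card_univ, Fintype.card_fin]
  ring

/-- Total mass of the patterns: `Σ_t M_t = Π_i (g_i + (1 − g_i)) = 1`. [folklore] -/
theorem sum_pattern_eq_one (g : Fin k → ℝ) :
    ∑ t ∈ (univ : Finset (Fin k)).powerset, ((∏ i ∈ t, g i) * ∏ i ∈ univ \ t, (1 - g i)) = 1 := by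
  have h := Finset.prod_add (fun i => g i) (fun i => 1 - g i) (univ : Finset (Fin k))
  simp only [add_sub_cancel, Finset.prod_const_one] at h
  exact h.symm

/-- **THEOREM (kernel branch of SOH_k on the independent stratum, all `k ≥ 2`).**  For `g_i ∈ [0,1]` with `o = Π(1 − g_i) > 0`,
`c_i = g_i Π_{j≠i}(1 − g_j)`, `κ = 1 − o − Σ c_i` (the outside, petal and kernel masses of the sunflower `U_i = G_i ∪ Maj₂(G)` of
independent events with `μ(G_i) = g_i`): **if `o ≤ κ` then `Π_i (κ + c_i) ≤ κ^{k−1}`.**  Proof: `o·[κ^{k−1} − Π(κ+c_i)] =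
Σ_{|t|≥2} M_t o² κ^{k−|t|} (κ^{|t|−2} − o^{|t|−2})`, termwise `≥ 0`. [this work] -/
theorem kernel_le_of_indepType (hk : 2 ≤ k) (g : Fin k → ℝ) (hg0 : ∀ i, 0 ≤ g i) (hg1 : ∀ i, g i ≤ 1)
    (ho : 0 < ∏ i, (1 - g i))
    (hle : ∏ i, (1 - g i) ≤ 1 - ∏ i, (1 - g i) - ∑ i, g i * ∏ j ∈ univ.erase i, (1 - g j)) :
    ∏ i, ((1 - ∏ j, (1 - g j) - ∑ j, g j * ∏ l ∈ univ.erase j, (1 - g l)) + g i * ∏ j ∈ univ.erase i, (1 - g j))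
      ≤ (1 - ∏ j, (1 - g j) - ∑ j, g j * ∏ l ∈ univ.erase j, (1 - g l)) ^ (k - 1) := by
  set o := ∏ j, (1 - g j) with hodef
  set c : Fin k → ℝ := fun i => g i * ∏ j ∈ univ.erase i, (1 - g j) with hcdef
  set κ := 1 - o - ∑ j, c j with hκdef
  have hq0 : ∀ i, 0 ≤ 1 - g i := fun i => sub_nonneg.2 (hg1 i)
  have hM0 : ∀ t : Finset (Fin k), 0 ≤ (∏ i ∈ t, g i) * ∏ i ∈ univ \ t, (1 - g i) := fun t =>
    mul_nonneg (Finset.prod_nonneg fun i _ => hg0 i) (Finset.prod_nonneg fun i _ => hq0 i)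
  have hκo : o ≤ κ := hle
  have hκpos : 0 < κ := lt_of_lt_of_le ho hκo
  -- (2) c_i · q_i = g_i · o
  have hcq : ∀ i, c i * (1 - g i) = g i * o := by
    intro i
    simp only [hcdef, hodef]
    rw [← Finset.mul_prod_erase univ (fun j => 1 - g j) (Finset.mem_univ i)]
    ring
  -- (3) Π(κ + c_i) · o = Π(κ q_i + o g_i)
  have h3 : (∏ i, (κ + c i)) * o = ∏ i, (κ * (1 - g i) + o * g i) := by
    calc (∏ i, (κ + c i)) * o = (∏ i, (κ + c i)) * ∏ i, (1 - g i) := by rw [hodef]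
      _ = ∏ i, ((κ + c i) * (1 - g i)) := Finset.prod_mul_distrib.symm
      _ = ∏ i, (κ * (1 - g i) + o * g i) := Finset.prod_congr rfl fun i _ => by linear_combination (hcq i)
  -- (4) expansion
  have h4 := prod_expand g κ o
  -- (5) the cells in pattern form: M ∅ = o, M {i} = c i, Σ_{|t|≥2} M t = κ
  have hM0' : (∏ i ∈ (∅ : Finset (Fin k)), g i) * ∏ i ∈ univ \ ∅, (1 - g i) = o := by
    simp [hodef]
  have hM1 : ∀ i, (∏ j ∈ ({i} : Finset (Fin k)), g j) * ∏ j ∈ univ \ {i}, (1 - g j) = c i := by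
    intro i
    simp only [hcdef, Finset.prod_singleton, Finset.sdiff_singleton_eq_erase]
  have hsum1 := sum_pattern_eq_one g
  rw [sum_powerset_split, hM0'] at hsum1
  simp only [hM1] at hsum1
  have hκM : κ = ∑ t ∈ (univ : Finset (Fin k)).powerset with 2 ≤ t.card, ((∏ i ∈ t, g i) * ∏ i ∈ univ \ t, (1 - g i)) := by
    rw [hκdef]
    have : ∑ j, c j = ∑ i, c i := rfl
    linarith
  -- main computation: κ^{k-1}·o − Π(κ+c_i)·o = Σ_{|t|≥2} M_t o² κ^{k−|t|} (κ^{|t|−2} − o^{|t|−2}) ≥ 0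
  have hexp : (∏ i, (κ + c i)) * o
      = κ ^ k * o + κ ^ (k - 1) * o * (∑ i, c i)
        + ∑ t ∈ (univ : Finset (Fin k)).powerset with 2 ≤ t.card,
            o ^ t.card * κ ^ (k - t.card) * ((∏ i ∈ t, g i) * ∏ i ∈ univ \ t, (1 - g i)) := by
    rw [h3, h4, sum_powerset_split, hM0']
    simp only [Finset.card_empty, pow_zero, one_mul, Nat.sub_zero, Finset.card_singleton, pow_one]
    have e2 : ∑ i, o * κ ^ (k - 1) * ((∏ j ∈ ({i} : Finset (Fin k)), g j) * ∏ j ∈ univ \ {i}, (1 - g j))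
        = κ ^ (k - 1) * o * ∑ i, c i := by
      rw [Finset.mul_sum]
      exact Finset.sum_congr rfl fun i _ => by rw [hM1]; ring
    rw [e2]
  have hk1 : κ ^ (k - 1) * o = κ ^ k * o + κ ^ (k - 1) * o * (∑ i, c i) + κ ^ (k - 1) * o * o := by
    have h1 : (1 : ℝ) = κ + o + ∑ i, c i := by rw [hκdef]; ring
    have : κ ^ k = κ ^ (k - 1) * κ := by
      rw [← pow_succ]; congr 1; omega
    calc κ ^ (k - 1) * o = κ ^ (k - 1) * o * (κ + o + ∑ i, c i) := by rw [← h1, mul_one]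
      _ = _ := by rw [this]; ring
  -- termwise comparison
  have hterm : ∀ t ∈ (univ : Finset (Fin k)).powerset.filter (fun t => 2 ≤ t.card),
      o ^ t.card * κ ^ (k - t.card) * ((∏ i ∈ t, g i) * ∏ i ∈ univ \ t, (1 - g i))
        ≤ κ ^ (k - 2) * o * o * ((∏ i ∈ t, g i) * ∏ i ∈ univ \ t, (1 - g i)) := by
    intro t ht
    rw [Finset.mem_filter, Finset.mem_powerset] at ht
    obtain ⟨hsub, h2⟩ := ht
    have htk : t.card ≤ k := by simpa using Finset.card_le_card hsub
    refine mul_le_mul_of_nonneg_right ?_ (hM0 t)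
    -- o^{|t|} κ^{k-|t|} ≤ κ^{k-2} o²  ⟸  o^{|t|-2} ≤ κ^{|t|-2}
    have e1 : o ^ t.card * κ ^ (k - t.card) = (o ^ (t.card - 2) * κ ^ (k - t.card)) * (o * o) := by
      have : o ^ t.card = o ^ (t.card - 2) * (o * o) := by
        rw [← pow_two, ← pow_add]; congr 1; omega
      rw [this]; ring
    have e2 : κ ^ (k - 2) * o * o = (κ ^ (t.card - 2) * κ ^ (k - t.card)) * (o * o) := by
      rw [← pow_add]
      have : t.card - 2 + (k - t.card) = k - 2 := by omega
      rw [this]; ring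
    rw [e1, e2]
    refine mul_le_mul_of_nonneg_right ?_ (mul_nonneg ho.le ho.le)
    exact mul_le_mul_of_nonneg_right (pow_le_pow_left₀ ho.le hκo _) (pow_nonneg hκpos.le _)
  have hsumle : ∑ t ∈ (univ : Finset (Fin k)).powerset with 2 ≤ t.card,
        o ^ t.card * κ ^ (k - t.card) * ((∏ i ∈ t, g i) * ∏ i ∈ univ \ t, (1 - g i))
      ≤ ∑ t ∈ (univ : Finset (Fin k)).powerset with 2 ≤ t.card, κ ^ (k - 2) * o * o * ((∏ i ∈ t, g i) * ∏ i ∈ univ \ t, (1 - g i)) :=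
    Finset.sum_le_sum hterm
  have hrhs : ∑ t ∈ (univ : Finset (Fin k)).powerset with 2 ≤ t.card, κ ^ (k - 2) * o * o * ((∏ i ∈ t, g i) * ∏ i ∈ univ \ t, (1 - g i))
      = κ ^ (k - 1) * o * o := by
    rw [← Finset.mul_sum, ← hκM]
    have : κ ^ (k - 1) = κ ^ (k - 2) * κ := by rw [← pow_succ]; congr 1; omega
    rw [this]; ring
  -- conclude: Π(κ+c_i)·o ≤ κ^{k-1}·o, divide by o > 0
  have hfinal : (∏ i, (κ + c i)) * o ≤ κ ^ (k - 1) * o := by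
    linarith [hexp, hk1, hsumle, hrhs]
  exact le_of_mul_le_mul_right hfinal ho



/-- **THEOREM (outside branch of SOH_k on the independent stratum is an EQUALITY, all `k`)**: `Π_i (o + c_i) = o^{k−1}` — the
complementary down-sets `D_i = ⋂_{j≠i} G_jᶜ` have `Π_i μ(D_i) = Π_i Π_{j≠i}(1−g_j) = μ(O)^{k−1}`. [this work] -/
theorem outside_exact_of_indepType (g : Fin k → ℝ) (ho : 0 < ∏ i, (1 - g i)) :
    ∏ i, ((∏ j, (1 - g j)) + g i * ∏ j ∈ univ.erase i, (1 - g j)) = (∏ j, (1 - g j)) ^ (k - 1) := by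
  set o := ∏ j, (1 - g j) with hodef
  -- o + c_i = Π_{j ≠ i} q_j
  have h1 : ∀ i, o + g i * ∏ j ∈ univ.erase i, (1 - g j) = ∏ j ∈ univ.erase i, (1 - g j) := by
    intro i
    rw [hodef, ← Finset.mul_prod_erase univ (fun j => 1 - g j) (Finset.mem_univ i)]
    ring
  simp only [h1]
  -- (Π_i Π_{j≠i} q_j) · o = o^k
  have h2 : (∏ i, ∏ j ∈ univ.erase i, (1 - g j)) * o = o ^ k := by
    rw [hodef, ← Finset.prod_mul_distrib]
    have : ∀ i : Fin k, (∏ j ∈ univ.erase i, (1 - g j)) * (1 - g i) = ∏ j, (1 - g j) := fun i =>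
      Finset.prod_erase_mul univ (fun j => 1 - g j) (Finset.mem_univ i)
    simp only [this, Finset.prod_const, Finset.card_univ, Fintype.card_fin]
  rcases Nat.eq_zero_or_pos k with hk | hk
  · subst hk; simp
  · have h3 : o ^ k = o ^ (k - 1) * o := by rw [← pow_succ]; congr 1; omega
    rw [h3] at h2
    exact mul_right_cancel₀ ho.ne' h2

/-- **THEOREM (the switch `κ = o` is EXACT, all `k ≥ 3`)**: on the independent stratum with all `g_i ∈ (0,1)`, if `κ < o` then the
kernel bound FAILS strictly: `κ^{k−1} < Π_i (κ + c_i)`.  Hence the hypothesis `μ(O) ≤ μ(K)` of the kernel half of `SunflowerOnePayer k`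
cannot be dropped for any `k ≥ 3`, and SOH_k is tight along `κ = o` at every `k`. [this work] -/
theorem kernel_gt_of_indepType (hk : 3 ≤ k) (g : Fin k → ℝ) (hg0 : ∀ i, 0 < g i) (hg1 : ∀ i, g i < 1)
    (hlt : 1 - ∏ i, (1 - g i) - ∑ i, g i * ∏ j ∈ univ.erase i, (1 - g j) < ∏ i, (1 - g i)) :
    (1 - ∏ j, (1 - g j) - ∑ j, g j * ∏ l ∈ univ.erase j, (1 - g l)) ^ (k - 1)
      < ∏ i, ((1 - ∏ j, (1 - g j) - ∑ j, g j * ∏ l ∈ univ.erase j, (1 - g l)) + g i * ∏ j ∈ univ.erase i, (1 - g j)) := by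
  set o := ∏ j, (1 - g j) with hodef
  set c : Fin k → ℝ := fun i => g i * ∏ j ∈ univ.erase i, (1 - g j) with hcdef
  set κ := 1 - o - ∑ j, c j with hκdef
  have hq0 : ∀ i, 0 < 1 - g i := fun i => sub_pos.2 (hg1 i)
  have ho : 0 < o := Finset.prod_pos fun i _ => hq0 i
  have hMpos : ∀ t : Finset (Fin k), 0 < (∏ i ∈ t, g i) * ∏ i ∈ univ \ t, (1 - g i) := fun t =>
    mul_pos (Finset.prod_pos fun i _ => hg0 i) (Finset.prod_pos fun i _ => hq0 i)
  have hκo : κ < o := hlt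
  -- κ > 0: κ ≥ M_t for a `t` with |t| = 3 ... via κ = Σ_{|t|≥2} M_t > 0
  have hcq : ∀ i, c i * (1 - g i) = g i * o := by
    intro i
    simp only [hcdef, hodef]
    rw [← Finset.mul_prod_erase univ (fun j => 1 - g j) (Finset.mem_univ i)]
    ring
  have h3 : (∏ i, (κ + c i)) * o = ∏ i, (κ * (1 - g i) + o * g i) := by
    calc (∏ i, (κ + c i)) * o = (∏ i, (κ + c i)) * ∏ i, (1 - g i) := by rw [hodef]
      _ = ∏ i, ((κ + c i) * (1 - g i)) := Finset.prod_mul_distrib.symm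
      _ = ∏ i, (κ * (1 - g i) + o * g i) := Finset.prod_congr rfl fun i _ => by linear_combination (hcq i)
  have h4 := prod_expand g κ o
  have hM0' : (∏ i ∈ (∅ : Finset (Fin k)), g i) * ∏ i ∈ univ \ ∅, (1 - g i) = o := by
    simp [hodef]
  have hM1 : ∀ i, (∏ j ∈ ({i} : Finset (Fin k)), g j) * ∏ j ∈ univ \ {i}, (1 - g j) = c i := by
    intro i
    simp only [hcdef, Finset.prod_singleton, Finset.sdiff_singleton_eq_erase]
  have hsum1 := sum_pattern_eq_one g
  rw [sum_powerset_split, hM0'] at hsum1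
  simp only [hM1] at hsum1
  have hκM : κ = ∑ t ∈ (univ : Finset (Fin k)).powerset with 2 ≤ t.card, ((∏ i ∈ t, g i) * ∏ i ∈ univ \ t, (1 - g i)) := by
    rw [hκdef]
    have : ∑ j, c j = ∑ i, c i := rfl
    linarith
  -- a set of size 3 exists
  obtain ⟨t3, ht3⟩ : ∃ t : Finset (Fin k), t.card = 3 := by
    obtain ⟨t, -, ht⟩ := Finset.exists_subset_card_eq (s := (univ : Finset (Fin k))) (n := 3) (by simpa using hk)
    exact ⟨t, ht⟩
  have ht3mem : t3 ∈ (univ : Finset (Fin k)).powerset.filter (fun t => 2 ≤ t.card) := by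
    simp [Finset.mem_filter, ht3]
  have hκpos : 0 < κ := by
    rw [hκM]
    exact lt_of_lt_of_le (hMpos t3) (Finset.single_le_sum (fun t _ => (hMpos t).le) ht3mem)
  have hexp : (∏ i, (κ + c i)) * o
      = κ ^ k * o + κ ^ (k - 1) * o * (∑ i, c i)
        + ∑ t ∈ (univ : Finset (Fin k)).powerset with 2 ≤ t.card,
            o ^ t.card * κ ^ (k - t.card) * ((∏ i ∈ t, g i) * ∏ i ∈ univ \ t, (1 - g i)) := by
    rw [h3, h4, sum_powerset_split, hM0']
    simp only [Finset.card_empty, pow_zero, one_mul, Nat.sub_zero, Finset.card_singleton, pow_one]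
    have e2 : ∑ i, o * κ ^ (k - 1) * ((∏ j ∈ ({i} : Finset (Fin k)), g j) * ∏ j ∈ univ \ {i}, (1 - g j))
        = κ ^ (k - 1) * o * ∑ i, c i := by
      rw [Finset.mul_sum]
      exact Finset.sum_congr rfl fun i _ => by rw [hM1]; ring
    rw [e2]
  have hk1 : κ ^ (k - 1) * o = κ ^ k * o + κ ^ (k - 1) * o * (∑ i, c i) + κ ^ (k - 1) * o * o := by
    have h1 : (1 : ℝ) = κ + o + ∑ i, c i := by rw [hκdef]; ring
    have : κ ^ k = κ ^ (k - 1) * κ := by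
      rw [← pow_succ]; congr 1; omega
    calc κ ^ (k - 1) * o = κ ^ (k - 1) * o * (κ + o + ∑ i, c i) := by rw [← h1, mul_one]
      _ = _ := by rw [this]; ring
  -- reversed termwise comparison, strict at `t3`
  have hterm : ∀ t ∈ (univ : Finset (Fin k)).powerset.filter (fun t => 2 ≤ t.card),
      κ ^ (k - 2) * o * o * ((∏ i ∈ t, g i) * ∏ i ∈ univ \ t, (1 - g i))
        ≤ o ^ t.card * κ ^ (k - t.card) * ((∏ i ∈ t, g i) * ∏ i ∈ univ \ t, (1 - g i)) := by
    intro t ht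
    rw [Finset.mem_filter, Finset.mem_powerset] at ht
    obtain ⟨hsub, h2⟩ := ht
    have htk : t.card ≤ k := by simpa using Finset.card_le_card hsub
    refine mul_le_mul_of_nonneg_right ?_ (hMpos t).le
    have e1 : o ^ t.card * κ ^ (k - t.card) = (o ^ (t.card - 2) * κ ^ (k - t.card)) * (o * o) := by
      have : o ^ t.card = o ^ (t.card - 2) * (o * o) := by
        rw [← pow_two, ← pow_add]; congr 1; omega
      rw [this]; ring
    have e2 : κ ^ (k - 2) * o * o = (κ ^ (t.card - 2) * κ ^ (k - t.card)) * (o * o) := by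
      rw [← pow_add]
      have : t.card - 2 + (k - t.card) = k - 2 := by omega
      rw [this]; ring
    rw [e1, e2]
    refine mul_le_mul_of_nonneg_right ?_ (mul_nonneg ho.le ho.le)
    exact mul_le_mul_of_nonneg_right (pow_le_pow_left₀ hκpos.le hκo.le _) (pow_nonneg hκpos.le _)
  have hstrict : κ ^ (k - 2) * o * o * ((∏ i ∈ t3, g i) * ∏ i ∈ univ \ t3, (1 - g i))
      < o ^ t3.card * κ ^ (k - t3.card) * ((∏ i ∈ t3, g i) * ∏ i ∈ univ \ t3, (1 - g i)) := by
    refine mul_lt_mul_of_pos_right ?_ (hMpos t3)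
    rw [ht3]
    have e2 : κ ^ (k - 2) * o * o = (κ * κ ^ (k - 3)) * (o * o) := by
      have : κ ^ (k - 2) = κ * κ ^ (k - 3) := by rw [← pow_succ']; congr 1; omega
      rw [this]; ring
    have e1 : o ^ 3 * κ ^ (k - 3) = (o * κ ^ (k - 3)) * (o * o) := by ring
    rw [e1, e2]
    refine mul_lt_mul_of_pos_right ?_ (mul_pos ho ho)
    exact mul_lt_mul_of_pos_right hκo (pow_pos hκpos _)
  have hsumlt : ∑ t ∈ (univ : Finset (Fin k)).powerset with 2 ≤ t.card, κ ^ (k - 2) * o * o * ((∏ i ∈ t, g i) * ∏ i ∈ univ \ t, (1 - g i))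
      < ∑ t ∈ (univ : Finset (Fin k)).powerset with 2 ≤ t.card,
          o ^ t.card * κ ^ (k - t.card) * ((∏ i ∈ t, g i) * ∏ i ∈ univ \ t, (1 - g i)) :=
    Finset.sum_lt_sum hterm ⟨t3, ht3mem, hstrict⟩
  have hrhs : ∑ t ∈ (univ : Finset (Fin k)).powerset with 2 ≤ t.card, κ ^ (k - 2) * o * o * ((∏ i ∈ t, g i) * ∏ i ∈ univ \ t, (1 - g i))
      = κ ^ (k - 1) * o * o := by
    rw [← Finset.mul_sum, ← hκM]
    have : κ ^ (k - 1) = κ ^ (k - 2) * κ := by rw [← pow_succ]; congr 1; omega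
    rw [this]; ring
  have hfinal : κ ^ (k - 1) * o < (∏ i, (κ + c i)) * o := by
    linarith [hexp, hk1, hsumlt, hrhs]
  exact lt_of_mul_lt_mul_right hfinal ho.le


end SahiDeepCore.IndepType

end Summit.CriticalPhenomena.PercolationContinuityZ3.Theorems

end
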